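import Summits.RiemannHypothesis.RiemannHypothesis.Theorems.PfPersistenceEdgeLawKink
import HarnessLib

/-!
# The kink law at the window `a = ½ log n₀` — RH-free helper

pub-rhpf (mechanism / rigidity campaign; **no RH claims**), theory-1 gen 5, THEORY-EDGE-5 §2.5.

Evaluation of the entering weight at the entering window of the integer `n₀ ≥ 2`:
`weilEnteringWeight (½ log n₀) = Λ(n₀) n₀^{-1/2}` (`weilEnteringWeight_half_log`; `log` is
injective on the positive integers), and the resulting literal form of the kink gap
(`Theorems/PfPersistenceEdgeLawKink`): one-sided derivatives `e₋, e₊` of `weilGroundEnergy` at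
`a = ½ log n₀` satisfy `e₋ − e₊ ≥ 4 Λ(n₀) n₀^{-1/2} · Re(g(a) conj g(−a))`
(`kink_gap_weilGroundEnergy_half_log`) — for a prime power `n₀ = p^k` and a real even state
with edge value `θ` this is the campaign's `4 (log p) p^{-k/2} θ²` (PF.md §14.2); for `n₀` not a
prime power `Λ(n₀) = 0` and there is no kink from prime entry.  Hypotheses as in the kink law
(named binders: interior-lag regularity of `D_t(ũ)`, edge continuity).  No RH content.
-/

set_option linter.dupNamespace false

noncomputable section

open MeasureTheory Set Filter
open scoped Topology ComplexConjugate

namespace Summit.RiemannHypothesis.RiemannHypothesis.Theorems.PfPersistence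

open Literature.NumberTheory.LFunctions
open Summit.RiemannHypothesis.RiemannHypothesis.Theorems.WeilWindowFlowWindowLipschitz

/-- **The entering weight at `a = ½ log n₀` is `Λ(n₀) n₀^{-1/2}`** (`2 ≤ n₀`). [folklore] -/
theorem weilEnteringWeight_half_log {n₀ : ℕ} (hn₀ : 2 ≤ n₀) :
    weilEnteringWeight (Real.log n₀ / 2) =
      (ArithmeticFunction.vonMangoldt n₀ : ℝ) / Real.sqrt n₀ := by
  have hpos0 : (0 : ℝ) < n₀ := by exact_mod_cast (by omega : 0 < n₀)
  have hlog0 : 0 < Real.log n₀ := Real.log_pos (by exact_mod_cast (by omega : 1 < n₀))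
  have h2a : 2 * (Real.log n₀ / 2) = Real.log n₀ := by ring
  unfold weilEnteringWeight weilLagIndex
  rw [h2a, Finset.filter_filter]
  refine Finset.sum_eq_single_of_mem n₀ ?_ ?_
  · simp only [Finset.mem_filter, mem_weilPrimeIndex, not_lt]
    exact ⟨by linarith, ⟨hn₀, le_rfl⟩, le_rfl⟩
  · intro n hn hne
    exfalso
    simp only [Finset.mem_filter, not_lt] at hn
    have heq : Real.log n = Real.log n₀ := le_antisymm hn.2.1.2 hn.2.2
    have hnpos : (0 : ℝ) < n := by
      have h2 : 2 ≤ n := hn.2.1.1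
      exact_mod_cast (by omega : 0 < n)
    have h := Real.log_injOn_pos (Set.mem_Ioi.2 hnpos) (Set.mem_Ioi.2 hpos0) heq
    exact hne (by exact_mod_cast h)

/-- For `n₀` not hit (`log n ≠ 2a` for all `2 ≤ n`) see `weilEnteringWeight_eq_zero`; at
`a = ½ log n₀` with `n₀` NOT a prime power the weight is `Λ(n₀) n₀^{-1/2} = 0`. [folklore] -/
theorem weilEnteringWeight_half_log_eq_zero {n₀ : ℕ} (hn₀ : 2 ≤ n₀) (hnp : ¬ IsPrimePow n₀) :
    weilEnteringWeight (Real.log n₀ / 2) = 0 := by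
  rw [weilEnteringWeight_half_log hn₀, ArithmeticFunction.vonMangoldt_eq_zero_iff.2 hnp, zero_div]

/-- **THE KINK GAP AT `a = ½ log n₀`.** For a ground state `u` of the window `a = ½ log n₀`
(`2 ≤ n₀`) with increment differentiable at the interior prime-power lags and edge values given
by `g ∈ C[−a, a]`: one-sided derivatives of `weilGroundEnergy` at `a` satisfy
`e₋ − e₊ ≥ 4 Λ(n₀) n₀^{-1/2} Re(g(a) conj g(−a))`. [folklore: Kato VII §6.5 + PF §14.2] -/
theorem kink_gap_weilGroundEnergy_half_log {n₀ : ℕ} (hn₀ : 2 ≤ n₀) {u g : ℝ → ℂ}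
    (hu : IsWeilGroundState (Real.log n₀ / 2) u) {d : ℕ → ℝ}
    (hd : ∀ n ∈ weilInteriorLagIndex (Real.log n₀ / 2),
      HasDerivAt (weilIncrement (weilTrunc (Real.log n₀ / 2) u)) (d n) (Real.log n))
    (hg : ContinuousOn g (Icc (-(Real.log n₀ / 2)) (Real.log n₀ / 2)))
    (hug : ∀ x ∈ Ioo (-(Real.log n₀ / 2)) (Real.log n₀ / 2), u x = g x) {em ep : ℝ}
    (hem : HasDerivWithinAt weilGroundEnergy em (Iio (Real.log n₀ / 2)) (Real.log n₀ / 2))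
    (hep : HasDerivWithinAt weilGroundEnergy ep (Ioi (Real.log n₀ / 2)) (Real.log n₀ / 2)) :
    4 * ((ArithmeticFunction.vonMangoldt n₀ : ℝ) / Real.sqrt n₀) *
        (g (Real.log n₀ / 2) * conj (g (-(Real.log n₀ / 2)))).re ≤ em - ep := by
  have h := kink_gap_weilGroundEnergy hu hd hg hug hem hep
  rwa [weilEnteringWeight_half_log hn₀] at h

/-- **A prime power entering with positive edge product forces a corner** at `a = ½ log n₀`.
[folklore: Kato VII §6.5 + PF §14.2] -/
theorem not_differentiableAt_weilGroundEnergy_half_log {n₀ : ℕ} (hn₀ : 2 ≤ n₀)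
    (hnp : IsPrimePow n₀) {u g : ℝ → ℂ} (hu : IsWeilGroundState (Real.log n₀ / 2) u) {d : ℕ → ℝ}
    (hd : ∀ n ∈ weilInteriorLagIndex (Real.log n₀ / 2),
      HasDerivAt (weilIncrement (weilTrunc (Real.log n₀ / 2) u)) (d n) (Real.log n))
    (hg : ContinuousOn g (Icc (-(Real.log n₀ / 2)) (Real.log n₀ / 2)))
    (hug : ∀ x ∈ Ioo (-(Real.log n₀ / 2)) (Real.log n₀ / 2), u x = g x)
    (hpos : 0 < (g (Real.log n₀ / 2) * conj (g (-(Real.log n₀ / 2)))).re) :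
    ¬ DifferentiableAt ℝ weilGroundEnergy (Real.log n₀ / 2) := by
  refine not_differentiableAt_weilGroundEnergy_of_edge hu hd hg hug ?_
  rw [weilEnteringWeight_half_log hn₀]
  have hΛ : 0 < (ArithmeticFunction.vonMangoldt n₀ : ℝ) :=
    ArithmeticFunction.vonMangoldt_pos_iff.2 hnp
  have hsq : 0 < Real.sqrt n₀ := Real.sqrt_pos.2 (by exact_mod_cast (by omega : 0 < n₀))
  positivity

end Summit.RiemannHypothesis.RiemannHypothesis.Theorems.PfPersistence

end
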